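import Mathlib.LinearAlgebra.FreeModule.Finite.Quotient
import Mathlib.LinearAlgebra.Matrix.ToLinearEquiv
import Mathlib.NumberTheory.Padics.RingHoms
import Literature.LinearAlgebra.FreeModule.DetQuotientDegree
import HarnessLib

/-!
# `#(M ⧸ φ(M)) = p^{v_p(det φ)}` for lattices over `ℤ_p`

Topic: `Literature/LinearAlgebra/FreeModule`; the `ℤ_p`-instance of "the length of the cokernel of
an injective endomorphism of a finite free module over a discrete valuation ring is the order of
its determinant" (Stacks 02QG), in the form used by Iwasawa-theoretic index computations: for a
finite free `ℤ_p`-module `M` and an injective `ℤ_p`-linear `φ : M → M`,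

* `natCard_quotient_range_eq_pow_valuation_det`: **`#(M ⧸ φ(M)) = p ^ v_p(det φ)`**;
* `natCard_quotient_eq_pow_valuation_det_equiv`: the same for a full sublattice `N ⊆ M` given as
  the image of an isomorphism `e : M ≃ N` (`#(M ⧸ N) = p ^ v_p(det (N ↪ M ∘ e))`, the `ℤ_p`
  analogue of Mathlib's `Submodule.natAbs_det_equiv` over `ℤ`);
* `natCard_quotient_range_toLin'_eq_pow_valuation_det`, `…_eq_norm_det_inv`: the matrix form,
  **`#(ℤ_p^ι ⧸ A ℤ_p^ι) = p ^ v_p(det A) = |det A|_p⁻¹`** for `A ∈ M_ι(ℤ_p)` with `det A ≠ 0`.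

This is the lemma that converts a `p`-adic regulator (a Gram determinant `det ⟨Pᵢ, Pⱼ⟩` of a
`ℤ_p`-valued pairing on a lattice) into the index of the adjoint map `L → Hom(L, ℤ_p)`, as in the
`Γ`-Euler-characteristic formula of Perrin-Riou and Schneider (Coates–Schneider–Sujatha 2003,
p. 204: `χ(Γ, Sel) = p^{-g} |ρ_p|_p^{-1}`, `ρ_p = R_p(E/F) · …`; Balakrishnan–Müller–Stein,
Math. Comp. 85 (2016), Thm. 1.7).

Proof: Smith normal form over the PID `ℤ_p` (Mathlib `Submodule.quotientEquivPiSpan`: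
`M ⧸ φ(M) ≃ Πᵢ ℤ_p ⧸ (aᵢ)`), `#ℤ_p/(a) = p^{v_p(a)}` (`natCard_padicInt_quotient_span_singleton`, via
`PadicInt.toZModPow`), and `det φ ∼ ∏ aᵢ` (tree theorem
`Literature.LinearAlgebra.FreeModule.associated_det_prod_smithNormalFormCoeffs`).

## References

* The Stacks Project, Tag 02QG. [StacksProject]
* J. Coates, P. Schneider, R. Sujatha, *Links between cyclotomic and GL₂ Iwasawa theory*,
  Doc. Math. Extra Vol. Kato (2003), 187–215, p. 204.
-/

noncomputable section

open Module

namespace Literature.LinearAlgebra.FreeModule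

variable {p : ℕ} [Fact p.Prime]

/-! ## `p`-adic valuation bookkeeping on `ℤ_p` -/

/-- Associated elements of `ℤ_p` have the same valuation (a unit has norm `1`, i.e. valuation
`0`; the stand-alone unit case is `Literature.MeasureTheory.Group.padicInt_valuation_unit`, not
imported here to keep this file measure-free). [folklore] -/
theorem padicInt_valuation_eq_of_associated {x y : ℤ_[p]} (h : Associated x y) :
    x.valuation = y.valuation := by
  obtain ⟨u, rfl⟩ := h
  by_cases hx : x = 0
  · simp [hx]
  have hu : ‖(u : ℤ_[p])‖ = 1 := PadicInt.norm_units u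
  rw [PadicInt.norm_eq_zpow_neg_valuation u.ne_zero] at hu
  have hp : (1 : ℝ) < p := by exact_mod_cast (Fact.out : p.Prime).one_lt
  have hu0 := (zpow_eq_one_iff_right₀ (zero_le_one.trans hp.le) hp.ne').mp hu
  rw [PadicInt.valuation_mul hx u.ne_zero]
  omega

/-- `v_p(∏ aᵢ) = ∑ v_p(aᵢ)` for non-zero `aᵢ ∈ ℤ_p`. [folklore] -/
theorem padicInt_valuation_prod {ι : Type*} (s : Finset ι) (f : ι → ℤ_[p])
    (hf : ∀ i ∈ s, f i ≠ 0) : (∏ i ∈ s, f i).valuation = ∑ i ∈ s, (f i).valuation := by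
  classical
  induction s using Finset.induction_on with
  | empty => simp
  | insert a s ha ih =>
    rw [Finset.prod_insert ha, Finset.sum_insert ha,
      PadicInt.valuation_mul (hf a (Finset.mem_insert_self a s))
        (Finset.prod_ne_zero_iff.mpr fun i hi => hf i (Finset.mem_insert_of_mem hi)),
      ih fun i hi => hf i (Finset.mem_insert_of_mem hi)]

/-- **`#ℤ_p/(x) = p^{v_p(x)}`** for `x ≠ 0`: `(x) = (p^{v_p(x)})` (`x = u p^{v_p(x)}`,
`PadicInt.unitCoeff_spec`) is the kernel of `ℤ_p ↠ ℤ/p^{v_p(x)}` (`PadicInt.ker_toZModPow`).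
[folklore] -/
theorem natCard_padicInt_quotient_span_singleton {x : ℤ_[p]} (hx : x ≠ 0) :
    Nat.card (ℤ_[p] ⧸ Ideal.span {x}) = p ^ x.valuation := by
  have hassoc : Associated x ((p : ℤ_[p]) ^ x.valuation) := by
    refine ⟨(PadicInt.unitCoeff hx)⁻¹, ?_⟩
    set u := PadicInt.unitCoeff hx
    have hspec : x = (u : ℤ_[p]) * (p : ℤ_[p]) ^ x.valuation := PadicInt.unitCoeff_spec hx
    calc x * ↑u⁻¹ = ((u : ℤ_[p]) * (p : ℤ_[p]) ^ x.valuation) * ↑u⁻¹ := by rw [← hspec]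
      _ = (p : ℤ_[p]) ^ x.valuation := by
        rw [mul_comm (u : ℤ_[p]), mul_assoc, Units.mul_inv, mul_one]
  rw [Ideal.span_singleton_eq_span_singleton.mpr hassoc, ← PadicInt.ker_toZModPow,
    Nat.card_congr (RingHom.quotientKerEquivOfSurjective
      (ZMod.ringHom_surjective (PadicInt.toZModPow x.valuation))).toEquiv, Nat.card_zmod]

/-! ## The index of a full sublattice -/

variable {M : Type*} [AddCommGroup M] [Module ℤ_[p] M]
variable {ι : Type*} [Fintype ι]

/-- **`#(M ⧸ φ(M)) = p ^ v_p(det φ)`** for an injective endomorphism `φ` of a finite free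
`ℤ_p`-module `M`: by the Smith normal form `M ⧸ φ(M) ≅ ⊕ᵢ ℤ_p/(aᵢ)` (Mathlib
`Submodule.quotientEquivPiSpan`) with `det φ ∼ ∏ aᵢ` (`associated_det_prod_smithNormalFormCoeffs`)
and `#ℤ_p/(aᵢ) = p^{v_p(aᵢ)}`. [cite: StacksProject, Tag 02QG] -/
theorem natCard_quotient_range_eq_pow_valuation_det (b : Basis ι ℤ_[p] M) (φ : M →ₗ[ℤ_[p]] M)
    (hφ : Function.Injective φ) :
    Nat.card (M ⧸ LinearMap.range φ) = p ^ (LinearMap.det φ).valuation := by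
  classical
  have h := LinearMap.finrank_range_of_inj hφ
  have hne := fun i => Submodule.smithNormalFormCoeffs_ne_zero b h i
  rw [Nat.card_congr ((LinearMap.range φ).quotientEquivPiSpan b h).toEquiv, Nat.card_pi,
    padicInt_valuation_eq_of_associated (associated_det_prod_smithNormalFormCoeffs b φ hφ h),
    padicInt_valuation_prod _ _ fun i _ => hne i, ← Finset.prod_pow_eq_pow_sum]
  exact Finset.prod_congr rfl fun i _ => natCard_padicInt_quotient_span_singleton (hne i)

/-- The cokernel of an injective endomorphism of a finite free `ℤ_p`-module is finite.
[cite: StacksProject, Tag 02QG] -/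
theorem finite_quotient_range_of_injective (b : Basis ι ℤ_[p] M) (φ : M →ₗ[ℤ_[p]] M)
    (hφ : Function.Injective φ) : Finite (M ⧸ LinearMap.range φ) := by
  apply Nat.finite_of_card_ne_zero
  rw [natCard_quotient_range_eq_pow_valuation_det b φ hφ]
  exact pow_ne_zero _ (Fact.out : p.Prime).ne_zero

/-- **`#(M ⧸ N) = p ^ v_p(det (N ↪ M ∘ e))`** for a submodule `N` of a finite free `ℤ_p`-module
`M` that is the image of an isomorphism `e : M ≃ N` (the `ℤ_p` analogue of Mathlib's
`Submodule.natAbs_det_equiv`). [cite: StacksProject, Tag 02QG] -/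
theorem natCard_quotient_eq_pow_valuation_det_equiv (b : Basis ι ℤ_[p] M)
    (N : Submodule ℤ_[p] M) (e : M ≃ₗ[ℤ_[p]] N) :
    Nat.card (M ⧸ N) = p ^ (LinearMap.det (N.subtype ∘ₗ (e : M →ₗ[ℤ_[p]] N))).valuation := by
  have hinj : Function.Injective (N.subtype ∘ₗ (e : M →ₗ[ℤ_[p]] N)) :=
    N.injective_subtype.comp e.injective
  have hrange : LinearMap.range (N.subtype ∘ₗ (e : M →ₗ[ℤ_[p]] N)) = N := by
    rw [LinearMap.range_comp, LinearEquiv.range, Submodule.map_top, Submodule.range_subtype]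
  rw [← natCard_quotient_range_eq_pow_valuation_det b _ hinj]
  exact Nat.card_congr (Submodule.quotEquivOfEq _ _ hrange.symm).toEquiv

/-! ## Matrix form -/

omit [Fintype ι] in
/-- A square matrix over `ℤ_p` with non-zero determinant acts injectively on `ℤ_p^ι`
(Mathlib `Matrix.exists_mulVec_eq_zero_iff` over the domain `ℤ_p`). [folklore] -/
theorem toLin'_injective_of_det_ne_zero [Fintype ι] [DecidableEq ι] (A : Matrix ι ι ℤ_[p])
    (hA : A.det ≠ 0) : Function.Injective (Matrix.toLin' A) := by
  rw [← LinearMap.ker_eq_bot, LinearMap.ker_eq_bot']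
  intro v hv
  by_contra hv0
  exact hA (Matrix.exists_mulVec_eq_zero_iff.mp ⟨v, hv0, by simpa using hv⟩)

/-- **`#(ℤ_p^ι ⧸ A ℤ_p^ι) = p ^ v_p(det A)`** for a square matrix `A` over `ℤ_p` with
`det A ≠ 0`. [cite: StacksProject, Tag 02QG] -/
theorem natCard_quotient_range_toLin'_eq_pow_valuation_det [DecidableEq ι]
    (A : Matrix ι ι ℤ_[p]) (hA : A.det ≠ 0) :
    Nat.card ((ι → ℤ_[p]) ⧸ LinearMap.range (Matrix.toLin' A)) = p ^ A.det.valuation := by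
  rw [natCard_quotient_range_eq_pow_valuation_det (Pi.basisFun ℤ_[p] ι) _
    (toLin'_injective_of_det_ne_zero A hA), LinearMap.det_toLin']

/-- The cokernel of a square matrix over `ℤ_p` with non-zero determinant is finite. [folklore] -/
theorem finite_quotient_range_toLin' [DecidableEq ι] (A : Matrix ι ι ℤ_[p]) (hA : A.det ≠ 0) :
    Finite ((ι → ℤ_[p]) ⧸ LinearMap.range (Matrix.toLin' A)) :=
  finite_quotient_range_of_injective (Pi.basisFun ℤ_[p] ι) _ (toLin'_injective_of_det_ne_zero A hA)

/-- **`#(ℤ_p^ι ⧸ A ℤ_p^ι) = |det A|_p⁻¹`** (the same statement through the `p`-adic absolute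
value, the shape in which regulators enter Euler-characteristic formulas,
e.g. Coates–Schneider–Sujatha (2003), p. 204). [cite: StacksProject, Tag 02QG] -/
theorem natCard_quotient_range_toLin'_eq_norm_det_inv [DecidableEq ι]
    (A : Matrix ι ι ℤ_[p]) (hA : A.det ≠ 0) :
    (Nat.card ((ι → ℤ_[p]) ⧸ LinearMap.range (Matrix.toLin' A)) : ℝ) = ‖A.det‖⁻¹ := by
  rw [natCard_quotient_range_toLin'_eq_pow_valuation_det A hA,
    PadicInt.norm_eq_zpow_neg_valuation hA, ← zpow_neg, neg_neg, zpow_natCast, Nat.cast_pow]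

end Literature.LinearAlgebra.FreeModule

end
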